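import Literature.Analysis.FluidPDE.TaoCascadeODE
import Mathlib.Analysis.ODE.Gronwall
import Mathlib.Analysis.SpecialFunctions.Pow.Asymptotics
import HarnessLib

/-!
# Tao's cascade ODE: the modes below the initial scale stay switched off ((4.13) of Lemma 4.1)

T. Tao, *Finite time blowup for an averaged three-dimensional Navier–Stokes equation*,
J. Amer. Math. Soc. **29** (2016), 601–674 = arXiv:1402.0290v3 (held as `paper:arxiv-1402.0290`),
§4, end of the proof of Lemma 4.1, pp. 22–23: "Finally, we prove (4.13). For `n < n₀`, we see
from (4.11), (4.8), (4.9) and the fundamental theorem of calculus that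
`E_{i,n}(t) ≤ Σ α (1+ε₀)^{5(n-μ₃)/2} ∫₀ᵗ X X X_{i,n}` … two of the terms may be bounded by
`Σ_{n<n₀} Σᵢ E_{i,n}` and the remaining term by (4.6) … By Gronwall's inequality, we conclude
that `Σ_{n<n₀} Σᵢ E_{i,n}(t) = 0` for all `t ≥ 0`, giving (4.13)."

This file proves that deduction **at the ODE layer** (namespace `TaoCascade`, over the accepted
`quadTerm` / `shiftSet` of `TaoCascadeODE.lean`), in the form consumed by the discharge of the
named fact `equationsOfMotion`: from the energy inequality (4.11) `∂ₜ E_{i,n} ≤ quadTerm · X_{i,n}`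
(right derivatives on `[0,T)`), the lower energy defect `½ X² ≤ E`, `E ≥ 0`, the vanishing
`E_{i,n}(0) = 0` for `n < n₀` and a uniform bound `|X_{i,n}| ≤ M` on `[0,T]` (Tao's (4.6)), it
follows that `E_{i,n} = 0` on `[0,T]` for every `n < n₀` (`lowMode_energy_eq_zero`), hence
`X_{i,n} = 0` there (`lowMode_coeff_eq_zero`).

## The argument (a finite-window variant of Tao's)

Every term `α (1+ε₀)^{5(n-μ₃)/2} X_{i₁,n-μ₃+μ₁} X_{i₂,n-μ₃+μ₂} X_{i,n}` driving a mode `n < n₀`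
contains, besides `X_{i,n}` itself, a second factor at a scale `≤ n` (the shifts
`(μ₁-μ₃, μ₂-μ₃) ∈ {(0,0),(1,0),(0,1),(-1,-1)}`), so with `|X_a X_b| ≤ E_a + E_b` the window energy
`F_N = Σᵢ Σ_{n₀-N ≤ n < n₀} E_{i,n}` obeys `F_N' ≤ K F_N + δ_N`, where `K` does not depend on `N`
and the inhomogeneity `δ_N = O((1+ε₀)^{5(n₀-N-1)/2})` comes only from the bottom scale of the
window; Mathlib's `gronwallBound` gives `F_N ≤ δ_N (e^{Kt}-1)/K → 0`. Unlike the printed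
argument this needs neither the cancellation (4.3) nor infinite sums. (The tree may also hold a
cancellation-based version of (4.13); the two are independent.)

## References

* T. Tao, J. Amer. Math. Soc. 29 (2016), 601–674, arXiv:1402.0290v3, §4 Lemma 4.1 (4.13),
  proof pp. 22–23. Key `Tao2016AveragedNS`.
-/

noncomputable section

open Set Filter Topology

namespace Literature.Analysis.FluidPDE

namespace TaoCascade

variable {ε₀ : ℝ} {m : ℕ}

/-! ### Elementary bounds -/

/-- The scale factor `(1+ε₀)^{5k/2}` of the cascade nonlinearity. [cite: Tao2016AveragedNS, §4 (4.1)] -/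
def scaleFactor (ε₀ : ℝ) (k : ℝ) : ℝ := (1 + ε₀) ^ ((5 : ℝ) * k / 2)

/-- The scale factor is positive (`ε₀ > -1`). [folklore] -/
theorem scaleFactor_pos (hε₀ : 0 < ε₀) (k : ℝ) : 0 < scaleFactor ε₀ k := by
  unfold scaleFactor; exact Real.rpow_pos_of_pos (by linarith) _

/-- The scale factor is monotone in the scale (`ε₀ > 0`). [folklore] -/
theorem scaleFactor_mono (hε₀ : 0 < ε₀) {k l : ℝ} (h : k ≤ l) : scaleFactor ε₀ k ≤ scaleFactor ε₀ l := by
  unfold scaleFactor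
  exact Real.rpow_le_rpow_of_exponent_le (by linarith) (by linarith)

/-- The scale factors tend to `0` as the scale tends to `-∞` (`ε₀ > 0`): along
`N ↦ 5(n₀ - N - 1)/2`. [folklore] -/
theorem tendsto_scaleFactor (hε₀ : 0 < ε₀) (a : ℝ) :
    Tendsto (fun N : ℕ => scaleFactor ε₀ (a - N)) atTop (𝓝 0) := by
  unfold scaleFactor
  have h1 : Tendsto (fun N : ℕ => (5 : ℝ) * (a - N) / 2) atTop atBot := by
    have h : Tendsto (fun N : ℕ => (N : ℝ)) atTop atTop := tendsto_natCast_atTop_atTop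
    have h2 : Tendsto (fun N : ℕ => (5 / 2 : ℝ) * a + (-(5 / 2 : ℝ)) * (N : ℝ)) atTop atBot :=
      tendsto_atBot_add_const_left _ _ (h.const_mul_atTop_of_neg (by norm_num))
    refine h2.congr fun N => ?_
    ring
  exact (tendsto_rpow_atBot_of_base_gt_one _ (by linarith)).comp h1

/-- A uniform bound for the structure constants on the shift set. [folklore] -/
def coeffBound (α : Fin m → Fin m → Fin m → ℤ × ℤ × ℤ → ℝ) : ℝ :=
  ∑ i₁, ∑ i₂, ∑ i₃, ∑ μ ∈ shiftSet, |α i₁ i₂ i₃ μ|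

/-- `|α_{i₁,i₂,i₃,μ}| ≤ coeffBound α` for `μ ∈ S`. [folklore] -/
theorem abs_le_coeffBound (α : Fin m → Fin m → Fin m → ℤ × ℤ × ℤ → ℝ) (i₁ i₂ i₃ : Fin m)
    {μ : ℤ × ℤ × ℤ} (hμ : μ ∈ shiftSet) : |α i₁ i₂ i₃ μ| ≤ coeffBound α := by
  unfold coeffBound
  refine le_trans ?_ (Finset.single_le_sum (f := fun i₁ => ∑ i₂, ∑ i₃, ∑ μ ∈ shiftSet, |α i₁ i₂ i₃ μ|)
    (fun _ _ => by positivity) (Finset.mem_univ i₁))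
  refine le_trans ?_ (Finset.single_le_sum (f := fun i₂ => ∑ i₃, ∑ μ ∈ shiftSet, |α i₁ i₂ i₃ μ|)
    (fun _ _ => by positivity) (Finset.mem_univ i₂))
  refine le_trans ?_ (Finset.single_le_sum (f := fun i₃ => ∑ μ ∈ shiftSet, |α i₁ i₂ i₃ μ|)
    (fun _ _ => by positivity) (Finset.mem_univ i₃))
  exact Finset.single_le_sum (f := fun μ => |α i₁ i₂ i₃ μ|) (fun _ _ => abs_nonneg _) hμ

/-- `coeffBound α ≥ 0`. [folklore] -/
theorem coeffBound_nonneg (α : Fin m → Fin m → Fin m → ℤ × ℤ × ℤ → ℝ) : 0 ≤ coeffBound α := by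
  unfold coeffBound; positivity

/-- `|x y| ≤ E + E'` when `½x² ≤ E` and `½y² ≤ E'` ("two of the terms may be bounded by
`Σ E`", Tao p. 23). [folklore] -/
theorem abs_mul_le_energy_add {x y E E' : ℝ} (hx : (1 / 2) * x ^ 2 ≤ E) (hy : (1 / 2) * y ^ 2 ≤ E') :
    |x * y| ≤ E + E' := by
  rw [abs_mul]
  nlinarith [sq_nonneg (|x| - |y|), sq_abs x, sq_abs y, abs_nonneg x, abs_nonneg y]

/-- `|x| ≤ ½ + E` when `½x² ≤ E`. [folklore] -/
theorem abs_le_half_add_energy {x E : ℝ} (hx : (1 / 2) * x ^ 2 ≤ E) : |x| ≤ 1 / 2 + E := by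
  nlinarith [sq_nonneg (|x| - 1), sq_abs x, abs_nonneg x]

/-! ### The window energy and the differential inequality -/

section Window

variable (E : Fin m → ℤ → ℝ → ℝ) (n₀ : ℤ) (N : ℕ)

/-- The **window energy** `F_N(t) = Σᵢ Σ_{n₀-N ≤ n < n₀} E_{i,n}(t)` of the `N` scales just below
the initial scale. [cite: Tao2016AveragedNS, §4 proof of (4.13)] -/
def windowEnergy (t : ℝ) : ℝ :=
  ∑ i, ∑ n ∈ Finset.Ico (n₀ - N) n₀, E i n t

/-- The energy of the window at one scale, `e(k) = Σⱼ E_{j,k}` if `n₀-N ≤ k < n₀`, else `0`. [folklore] -/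
def scaleEnergy (k : ℤ) (t : ℝ) : ℝ :=
  if k ∈ Finset.Ico (n₀ - N) n₀ then ∑ j, E j k t else 0

variable {E n₀ N}

/-- A single energy in the window is at most the scale energy. [folklore] -/
theorem le_scaleEnergy (hE : ∀ j k t, 0 ≤ E j k t) {k : ℤ} (hk : k ∈ Finset.Ico (n₀ - N) n₀)
    (j : Fin m) (t : ℝ) : E j k t ≤ scaleEnergy E n₀ N k t := by
  unfold scaleEnergy
  rw [if_pos hk]
  exact Finset.single_le_sum (f := fun j => E j k t) (fun _ _ => hE _ _ _) (Finset.mem_univ j)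

/-- The scale energies are non-negative. [folklore] -/
theorem scaleEnergy_nonneg (hE : ∀ j k t, 0 ≤ E j k t) (k : ℤ) (t : ℝ) : 0 ≤ scaleEnergy E n₀ N k t := by
  unfold scaleEnergy
  split_ifs
  · exact Finset.sum_nonneg fun j _ => hE j k t
  · exact le_rfl

/-- Summing the scale energies over the window gives the window energy. [folklore] -/
theorem sum_scaleEnergy (t : ℝ) :
    ∑ n ∈ Finset.Ico (n₀ - N) n₀, scaleEnergy E n₀ N n t = windowEnergy E n₀ N t := by
  unfold scaleEnergy windowEnergy
  rw [Finset.sum_comm]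
  exact Finset.sum_congr rfl fun n hn => if_pos hn

/-- Summing the shifted scale energies `e(n-1)` over the window gives at most the window energy
(the bottom term `e(n₀-N-1)` vanishes, the top term `e(n₀-1)` is dropped). [folklore] -/
theorem sum_scaleEnergy_pred_le (hE : ∀ j k t, 0 ≤ E j k t) (t : ℝ) :
    ∑ n ∈ Finset.Ico (n₀ - N) n₀, scaleEnergy E n₀ N (n - 1) t ≤ windowEnergy E n₀ N t := by
  rw [← sum_scaleEnergy]
  -- reindex `n ↦ n - 1` : the image of the window is `Ico (n₀-N-1) (n₀-1)`
  have himage : (Finset.Ico (n₀ - N) n₀).image (fun n : ℤ => n - 1) = Finset.Ico (n₀ - N - 1) (n₀ - 1) := by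
    ext k
    simp only [Finset.mem_image, Finset.mem_Ico]
    constructor
    · rintro ⟨n, ⟨h1, h2⟩, rfl⟩
      exact ⟨by omega, by omega⟩
    · rintro ⟨h1, h2⟩
      exact ⟨k + 1, ⟨by omega, by omega⟩, by omega⟩
  have hsum : ∑ n ∈ Finset.Ico (n₀ - N) n₀, scaleEnergy E n₀ N (n - 1) t =
      ∑ k ∈ Finset.Ico (n₀ - N - 1) (n₀ - 1), scaleEnergy E n₀ N k t := by
    rw [← himage, Finset.sum_image fun a _ b _ h => by simpa using h]
  rw [hsum]
  -- the bottom term vanishes and the rest is a subset of the window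
  have hzero : scaleEnergy E n₀ N (n₀ - N - 1) t = 0 := by
    unfold scaleEnergy
    rw [if_neg (by simp)]
  rw [← Finset.sum_erase (Finset.Ico (n₀ - N - 1) (n₀ - 1)) (f := fun k => scaleEnergy E n₀ N k t) hzero]
  refine Finset.sum_le_sum_of_subset_of_nonneg (fun k hk => ?_) fun k _ _ => scaleEnergy_nonneg hE k t
  simp only [Finset.mem_erase, Finset.mem_Ico] at hk ⊢
  omega

end Window

/-! ### The driving terms of a low mode have two low factors -/

section Terms

variable (hε₀ : 0 < ε₀) {α : Fin m → Fin m → Fin m → ℤ × ℤ × ℤ → ℝ}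
  {X E : Fin m → ℤ → ℝ → ℝ} {n₀ : ℤ} {N : ℕ} {M : ℝ} {t : ℝ}

include hε₀

/-- **Bound for one driving term of a mode in the window.** For `n₀-N ≤ n < n₀`, `μ ∈ S`:
`α_{i₁,i₂,i,μ} (1+ε₀)^{5(n-μ₃)/2} X_{i₁,n-μ₃+μ₁} X_{i₂,n-μ₃+μ₂} X_{i,n}
  ≤ 2 ᾱ c_{n₀} (M + M²) (e(n) + e(n-1)) + [n = n₀-N] ᾱ M² c_{n₀-N-1} / 2`,
with `ᾱ = coeffBound α`, `c_k = (1+ε₀)^{5k/2}`, `e` the scale energies of the window, given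
`½X² ≤ E`, `E ≥ 0` and `|X| ≤ M` ("two of the terms may be bounded by `Σ E`, and the remaining
term by (4.6)", Tao p. 23). [cite: Tao2016AveragedNS, §4 proof of (4.13)] -/
theorem driving_term_le (hM : 0 ≤ M) (hX : ∀ j k, |X j k t| ≤ M) (hE : ∀ j k s, 0 ≤ E j k s)
    (hXE : ∀ j k, (1 / 2) * X j k t ^ 2 ≤ E j k t) {n : ℤ} (hn : n ∈ Finset.Ico (n₀ - N) n₀)
    (i i₁ i₂ : Fin m) {μ : ℤ × ℤ × ℤ} (hμ : μ ∈ shiftSet) :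
    α i₁ i₂ i μ * (1 + ε₀) ^ ((5 : ℝ) * (n - μ.2.2) / 2) *
        (X i₁ (n - μ.2.2 + μ.1) t * X i₂ (n - μ.2.2 + μ.2.1) t) * X i n t ≤
      coeffBound α * scaleFactor ε₀ n₀ * (M + M ^ 2) *
          (2 * (scaleEnergy E n₀ N n t + scaleEnergy E n₀ N (n - 1) t)) +
        (if n = n₀ - N then coeffBound α * M ^ 2 * scaleFactor ε₀ (n₀ - N - 1) / 2 else 0) := by
  have hᾱ := abs_le_coeffBound α i₁ i₂ i hμ
  have hᾱ0 := coeffBound_nonneg α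
  have hen := scaleEnergy_nonneg (n₀ := n₀) (N := N) hE n t
  have hen1 := scaleEnergy_nonneg (n₀ := n₀) (N := N) hE (n - 1) t
  have hcn : (1 + ε₀) ^ ((5 : ℝ) * (n - μ.2.2) / 2) ≤ scaleFactor ε₀ n₀ := by
    have hμ3 : (0 : ℝ) ≤ μ.2.2 := by
      rcases (mem_shiftSet_iff μ).1 hμ with h | h | h | h <;> simp [h]
    have hn' : (n : ℝ) ≤ n₀ := by
      have := (Finset.mem_Ico.1 hn).2
      exact_mod_cast this.le
    exact scaleFactor_mono hε₀ (k := (n : ℝ) - μ.2.2) (l := n₀) (by linarith)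
  have hc0 : 0 ≤ (1 + ε₀) ^ ((5 : ℝ) * (n - μ.2.2) / 2) := (Real.rpow_pos_of_pos (by linarith) _).le
  have hδ0 : 0 ≤ (if n = n₀ - N then coeffBound α * M ^ 2 * scaleFactor ε₀ (n₀ - N - 1) / 2 else 0) := by
    split_ifs
    · have := (scaleFactor_pos hε₀ (n₀ - N - 1)).le
      positivity
    · exact le_rfl
  -- the generic estimate: a low factor `y` next to `X_{i,n}` and a bounded factor `z`
  have key : ∀ (y z : ℝ) (ey : ℝ), (1 / 2) * y ^ 2 ≤ ey → 0 ≤ ey → ey ≤ scaleEnergy E n₀ N n t ∨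
      ey ≤ scaleEnergy E n₀ N (n - 1) t → |z| ≤ M →
      α i₁ i₂ i μ * (1 + ε₀) ^ ((5 : ℝ) * (n - μ.2.2) / 2) * (y * z) * X i n t ≤
        coeffBound α * scaleFactor ε₀ n₀ * (M + M ^ 2) *
          (2 * (scaleEnergy E n₀ N n t + scaleEnergy E n₀ N (n - 1) t)) := by
    intro y z ey hy hey0 hey hz
    have h1 : |y * X i n t| ≤ ey + E i n t := abs_mul_le_energy_add hy (hXE i n)
    have h2 : E i n t ≤ scaleEnergy E n₀ N n t := le_scaleEnergy hE hn i t
    have h3 : ey + E i n t ≤ 2 * (scaleEnergy E n₀ N n t + scaleEnergy E n₀ N (n - 1) t) := by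
      rcases hey with h | h <;> linarith
    have hc₀ := (scaleFactor_pos hε₀ (n₀ : ℝ)).le
    calc α i₁ i₂ i μ * (1 + ε₀) ^ ((5 : ℝ) * (n - μ.2.2) / 2) * (y * z) * X i n t
        ≤ |α i₁ i₂ i μ * (1 + ε₀) ^ ((5 : ℝ) * (n - μ.2.2) / 2) * (y * z) * X i n t| := le_abs_self _
      _ = |α i₁ i₂ i μ| * (1 + ε₀) ^ ((5 : ℝ) * (n - μ.2.2) / 2) * |z| * |y * X i n t| := by
          rw [abs_mul, abs_mul, abs_mul, abs_mul, abs_of_nonneg hc0, abs_mul]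
          ring
      _ ≤ coeffBound α * scaleFactor ε₀ n₀ * M *
          (2 * (scaleEnergy E n₀ N n t + scaleEnergy E n₀ N (n - 1) t)) :=
          mul_le_mul (mul_le_mul (mul_le_mul hᾱ hcn hc0 hᾱ0) hz (abs_nonneg z)
            (mul_nonneg hᾱ0 hc₀)) (h1.trans h3) (abs_nonneg _) (by positivity)
      _ ≤ coeffBound α * scaleFactor ε₀ n₀ * (M + M ^ 2) *
          (2 * (scaleEnergy E n₀ N n t + scaleEnergy E n₀ N (n - 1) t)) := by
          refine mul_le_mul_of_nonneg_right (mul_le_mul_of_nonneg_left ?_ (mul_nonneg hᾱ0 hc₀))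
            (by positivity)
          nlinarith [sq_nonneg M]
  rcases (mem_shiftSet_iff μ).1 hμ with h | h | h | h
  · -- μ = (0,0,0): factors X_{i₁,n}, X_{i₂,n}; take y = X_{i₁,n}
    subst h
    simp only [sub_zero, add_zero] at *
    have := key (X i₁ n t) (X i₂ n t) (E i₁ n t) (hXE i₁ n) (hE i₁ n t)
      (Or.inl (le_scaleEnergy hE hn i₁ t)) (hX i₂ n)
    simp only [Int.cast_zero, sub_zero] at this ⊢
    linarith
  · -- μ = (1,0,0): factors X_{i₁,n+1}, X_{i₂,n}; take y = X_{i₂,n}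
    subst h
    have := key (X i₂ n t) (X i₁ (n + 1) t) (E i₂ n t) (hXE i₂ n) (hE i₂ n t)
      (Or.inl (le_scaleEnergy hE hn i₂ t)) (hX i₁ (n + 1))
    simp only [Int.cast_zero, sub_zero, add_zero] at this ⊢
    rw [mul_comm (X i₁ (n + 1) t) (X i₂ n t)]
    linarith
  · -- μ = (0,1,0): factors X_{i₁,n}, X_{i₂,n+1}; take y = X_{i₁,n}
    subst h
    have := key (X i₁ n t) (X i₂ (n + 1) t) (E i₁ n t) (hXE i₁ n) (hE i₁ n t)
      (Or.inl (le_scaleEnergy hE hn i₁ t)) (hX i₂ (n + 1))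
    simp only [Int.cast_zero, sub_zero, add_zero] at this ⊢
    linarith
  · -- μ = (0,0,1): factors X_{i₁,n-1}, X_{i₂,n-1}
    subst h
    simp only [Int.cast_one, add_zero]
    by_cases hb : n = n₀ - N
    · -- bottom of the window: both factors are below it, bound them by `M`
      rw [if_pos hb]
      have h1 : |X i n t| ≤ 1 / 2 + E i n t := abs_le_half_add_energy (hXE i n)
      have h2 : E i n t ≤ scaleEnergy E n₀ N n t := le_scaleEnergy hE hn i t
      have hcb : (1 + ε₀) ^ ((5 : ℝ) * (n - 1) / 2) = scaleFactor ε₀ (n₀ - N - 1) := by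
        unfold scaleFactor
        rw [hb]
        push_cast
        ring_nf
      have hcs : scaleFactor ε₀ (n₀ - N - 1) ≤ scaleFactor ε₀ n₀ := scaleFactor_mono hε₀ (by
        have : (0 : ℝ) ≤ N := N.cast_nonneg
        linarith)
      have hcpos := (scaleFactor_pos hε₀ (n₀ - N - 1)).le
      have hc₀ := (scaleFactor_pos hε₀ (n₀ : ℝ)).le
      have s1 : coeffBound α * scaleFactor ε₀ (n₀ - N - 1) * (M * M) * (1 / 2 + E i n t) =
          coeffBound α * M ^ 2 * scaleFactor ε₀ (n₀ - N - 1) / 2 +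
            (coeffBound α * M ^ 2) * (scaleFactor ε₀ (n₀ - N - 1) * E i n t) := by ring
      have s2 : (coeffBound α * M ^ 2) * (scaleFactor ε₀ (n₀ - N - 1) * E i n t) ≤
          coeffBound α * scaleFactor ε₀ n₀ * (M + M ^ 2) *
            (2 * (scaleEnergy E n₀ N n t + scaleEnergy E n₀ N (n - 1) t)) := by
        have h3 : scaleFactor ε₀ (n₀ - N - 1) * E i n t ≤
            scaleFactor ε₀ n₀ * (2 * (scaleEnergy E n₀ N n t + scaleEnergy E n₀ N (n - 1) t)) :=
          mul_le_mul hcs (by linarith [hE i n t]) (hE i n t) hc₀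
        calc (coeffBound α * M ^ 2) * (scaleFactor ε₀ (n₀ - N - 1) * E i n t)
            ≤ (coeffBound α * M ^ 2) *
              (scaleFactor ε₀ n₀ * (2 * (scaleEnergy E n₀ N n t + scaleEnergy E n₀ N (n - 1) t))) :=
              mul_le_mul_of_nonneg_left h3 (by positivity)
          _ ≤ (coeffBound α * (M + M ^ 2)) *
              (scaleFactor ε₀ n₀ * (2 * (scaleEnergy E n₀ N n t + scaleEnergy E n₀ N (n - 1) t))) := by
              refine mul_le_mul_of_nonneg_right (mul_le_mul_of_nonneg_left (by nlinarith [sq_nonneg M]) hᾱ0) ?_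
              positivity
          _ = _ := by ring
      calc α i₁ i₂ i (0, 0, 1) * (1 + ε₀) ^ ((5 : ℝ) * (n - 1) / 2) *
            (X i₁ (n - 1) t * X i₂ (n - 1) t) * X i n t
          ≤ |α i₁ i₂ i (0, 0, 1) * (1 + ε₀) ^ ((5 : ℝ) * (n - 1) / 2) *
            (X i₁ (n - 1) t * X i₂ (n - 1) t) * X i n t| := le_abs_self _
        _ = |α i₁ i₂ i (0, 0, 1)| * scaleFactor ε₀ (n₀ - N - 1) *
              (|X i₁ (n - 1) t| * |X i₂ (n - 1) t|) * |X i n t| := by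
            rw [abs_mul, abs_mul, abs_mul, abs_mul, hcb, abs_of_nonneg hcpos]
        _ ≤ coeffBound α * scaleFactor ε₀ (n₀ - N - 1) * (M * M) * (1 / 2 + E i n t) := by
            have := abs_nonneg (X i n t)
            have := abs_nonneg (X i₁ (n - 1) t)
            have := abs_nonneg (X i₂ (n - 1) t)
            gcongr
            exacts [hX _ _, hX _ _]
        _ ≤ coeffBound α * scaleFactor ε₀ n₀ * (M + M ^ 2) *
              (2 * (scaleEnergy E n₀ N n t + scaleEnergy E n₀ N (n - 1) t)) +
            coeffBound α * M ^ 2 * scaleFactor ε₀ (n₀ - N - 1) / 2 := by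
            linarith [s1, s2]
    · -- interior: `n - 1` is in the window, take `y = X_{i₁,n-1}`
      rw [if_neg hb]
      have hn1 : n - 1 ∈ Finset.Ico (n₀ - N) n₀ := by
        simp only [Finset.mem_Ico] at hn ⊢
        omega
      have := key (X i₁ (n - 1) t) (X i₂ (n - 1) t) (E i₁ (n - 1) t) (hXE i₁ (n - 1))
        (hE i₁ (n - 1) t) (Or.inr (le_scaleEnergy hE hn1 i₁ t)) (hX i₂ (n - 1))
      simp only [Int.cast_one] at this
      linarith

/-- **The differential inequality for the window energy**: the total drive
`Σᵢ Σ_{n in window} quadTerm_{i,n} X_{i,n}` is at most `K F_N + δ_N`, with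
`K = 16 m³ ᾱ c_{n₀} (M + M²)` independent of `N` and `δ_N = 4 m³ ᾱ M² c_{n₀-N-1}/2`. [cite: Tao2016AveragedNS, §4 proof of (4.13)] -/
theorem sum_quadTerm_mul_le_window (hM : 0 ≤ M) (hX : ∀ j k, |X j k t| ≤ M)
    (hE : ∀ j k s, 0 ≤ E j k s) (hXE : ∀ j k, (1 / 2) * X j k t ^ 2 ≤ E j k t) :
    ∑ i, ∑ n ∈ Finset.Ico (n₀ - N) n₀, quadTerm ε₀ α X i n t * X i n t ≤
      (16 * (m : ℝ) ^ 3 * coeffBound α * scaleFactor ε₀ n₀ * (M + M ^ 2)) * windowEnergy E n₀ N t +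
        4 * (m : ℝ) ^ 3 * (coeffBound α * M ^ 2 * scaleFactor ε₀ (n₀ - N - 1) / 2) := by
  -- distribute `X_{i,n}` into the terms of `quadTerm`
  have hexp : ∀ (i : Fin m) (n : ℤ), quadTerm ε₀ α X i n t * X i n t =
      ∑ i₁, ∑ i₂, ∑ μ ∈ shiftSet, α i₁ i₂ i μ * (1 + ε₀) ^ ((5 : ℝ) * (n - μ.2.2) / 2) *
        (X i₁ (n - μ.2.2 + μ.1) t * X i₂ (n - μ.2.2 + μ.2.1) t) * X i n t := by
    intro i n
    unfold quadTerm
    simp only [Finset.sum_mul]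
  simp_rw [hexp]
  -- bound every term
  set A : ℝ := coeffBound α * scaleFactor ε₀ n₀ * (M + M ^ 2) with hA
  set δ : ℝ := coeffBound α * M ^ 2 * scaleFactor ε₀ (n₀ - N - 1) / 2 with hδ
  have hcard : (shiftSet.card : ℝ) = 4 := by
    rw [shiftSet]; norm_num
  calc ∑ i, ∑ n ∈ Finset.Ico (n₀ - N) n₀, ∑ i₁, ∑ i₂, ∑ μ ∈ shiftSet,
        α i₁ i₂ i μ * (1 + ε₀) ^ ((5 : ℝ) * (n - μ.2.2) / 2) *
          (X i₁ (n - μ.2.2 + μ.1) t * X i₂ (n - μ.2.2 + μ.2.1) t) * X i n t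
      ≤ ∑ i : Fin m, ∑ n ∈ Finset.Ico (n₀ - N) n₀, ∑ i₁ : Fin m, ∑ i₂ : Fin m, ∑ μ ∈ shiftSet,
          (A * (2 * (scaleEnergy E n₀ N n t + scaleEnergy E n₀ N (n - 1) t)) +
            (if n = n₀ - N then δ else 0)) := by
        gcongr with i _ n hn i₁ _ i₂ _ μ hμ
        exact driving_term_le hε₀ hM hX hE hXE hn i i₁ i₂ hμ
    _ = ∑ n ∈ Finset.Ico (n₀ - N) n₀, (4 * (m : ℝ) ^ 3) *
          (A * (2 * (scaleEnergy E n₀ N n t + scaleEnergy E n₀ N (n - 1) t)) +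
            (if n = n₀ - N then δ else 0)) := by
        rw [Finset.sum_comm]
        refine Finset.sum_congr rfl fun n _ => ?_
        simp only [Finset.sum_const, Finset.card_univ, Fintype.card_fin, nsmul_eq_mul, hcard]
        ring
    _ = (4 * (m : ℝ) ^ 3) * (A * (2 * (∑ n ∈ Finset.Ico (n₀ - N) n₀, scaleEnergy E n₀ N n t +
          ∑ n ∈ Finset.Ico (n₀ - N) n₀, scaleEnergy E n₀ N (n - 1) t)) +
          ∑ n ∈ Finset.Ico (n₀ - N) n₀, (if n = n₀ - N then δ else 0)) := by
        rw [← Finset.mul_sum, Finset.sum_add_distrib, ← Finset.mul_sum, ← Finset.mul_sum,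
          Finset.sum_add_distrib]
    _ ≤ (4 * (m : ℝ) ^ 3) * (A * (2 * (windowEnergy E n₀ N t + windowEnergy E n₀ N t)) + δ) := by
        have hA0 : 0 ≤ A := by
          have := (scaleFactor_pos hε₀ (n₀ : ℝ)).le
          have := coeffBound_nonneg α
          positivity
        have hδ0 : 0 ≤ δ := by
          have := (scaleFactor_pos hε₀ (n₀ - N - 1)).le
          have := coeffBound_nonneg α
          positivity
        have hind : ∑ n ∈ Finset.Ico (n₀ - N) n₀, (if n = n₀ - N then δ else 0) ≤ δ := by
          rw [Finset.sum_ite_eq']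
          split_ifs
          · exact le_rfl
          · exact hδ0
        gcongr
        · rw [sum_scaleEnergy]
        · exact sum_scaleEnergy_pred_le hE t
    _ = (16 * (m : ℝ) ^ 3 * coeffBound α * scaleFactor ε₀ n₀ * (M + M ^ 2)) * windowEnergy E n₀ N t +
        4 * (m : ℝ) ^ 3 * (coeffBound α * M ^ 2 * scaleFactor ε₀ (n₀ - N - 1) / 2) := by
        rw [hA, hδ]
        ring

end Terms

/-! ### Gronwall and the vanishing of the low modes -/

/-- **The modes below the initial scale carry no energy** ((4.13) of Tao's Lemma 4.1, energy
half): if on `[0,T]` the energies `E_{i,n} ≥ 0` are continuous with right derivatives `dE_{i,n}`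
obeying the energy inequality (4.11) `dE_{i,n} ≤ quadTerm_{i,n} X_{i,n}`, the lower defect
`½ X_{i,n}² ≤ E_{i,n}` ((4.12)), the initial vanishing `E_{i,n}(0) = 0` for `n < n₀` ((4.8)–(4.9))
and the uniform bound `|X_{i,n}| ≤ M` ((4.6)), then `E_{i,n} = 0` on `[0,T]` for all `n < n₀`
(Tao, pp. 22–23, by Gronwall). [cite: Tao2016AveragedNS, Lemma 4.1 (4.13)] -/
theorem lowMode_energy_eq_zero (hε₀ : 0 < ε₀) (α : Fin m → Fin m → Fin m → ℤ × ℤ × ℤ → ℝ) (n₀ : ℤ)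
    (X E dE : Fin m → ℤ → ℝ → ℝ) {T : ℝ}
    (hcont : ∀ i n, ContinuousOn (E i n) (Icc 0 T))
    (hderiv : ∀ i n, ∀ t ∈ Ico 0 T, HasDerivWithinAt (E i n) (dE i n t) (Ici t) t)
    (henergy : ∀ i n, ∀ t ∈ Ico 0 T, dE i n t ≤ quadTerm ε₀ α X i n t * X i n t)
    (hlower : ∀ i n, ∀ t ∈ Icc 0 T, (1 / 2) * X i n t ^ 2 ≤ E i n t)
    (hnonneg : ∀ i n t, 0 ≤ E i n t)
    (hinit : ∀ i n, n < n₀ → E i n 0 = 0)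
    {M : ℝ} (hM : 0 ≤ M) (hbound : ∀ i n, ∀ t ∈ Icc 0 T, |X i n t| ≤ M) :
    ∀ i n, n < n₀ → ∀ t ∈ Icc 0 T, E i n t = 0 := by
  intro i n hn t ht
  set K : ℝ := 16 * (m : ℝ) ^ 3 * coeffBound α * scaleFactor ε₀ n₀ * (M + M ^ 2) with hK
  set δ : ℕ → ℝ := fun N => 4 * (m : ℝ) ^ 3 * (coeffBound α * M ^ 2 * scaleFactor ε₀ (n₀ - N - 1) / 2)
    with hδ
  -- Gronwall for each window
  have hwin : ∀ N : ℕ, ∀ s ∈ Icc 0 T, windowEnergy E n₀ N s ≤ gronwallBound 0 K (δ N) (s - 0) := by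
    intro N
    refine le_gronwallBound_of_liminf_deriv_right_le (f' := fun s => ∑ i, ∑ n ∈ Finset.Ico (n₀ - N) n₀, dE i n s)
      ?_ ?_ ?_ ?_
    · unfold windowEnergy
      exact continuousOn_finsetSum _ fun i _ => continuousOn_finsetSum _ fun n _ => hcont i n
    · intro s hs r hr
      have hd : HasDerivWithinAt (windowEnergy E n₀ N) (∑ i, ∑ n ∈ Finset.Ico (n₀ - N) n₀, dE i n s)
          (Ici s) s := by
        unfold windowEnergy
        exact HasDerivWithinAt.fun_sum fun i _ => HasDerivWithinAt.fun_sum fun n _ => hderiv i n s hs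
      exact hd.liminf_right_slope_le hr
    · unfold windowEnergy
      rw [Finset.sum_eq_zero fun i _ => Finset.sum_eq_zero fun n hn' => hinit i n (Finset.mem_Ico.1 hn').2]
    · intro s hs
      calc ∑ i, ∑ n ∈ Finset.Ico (n₀ - N) n₀, dE i n s
          ≤ ∑ i, ∑ n ∈ Finset.Ico (n₀ - N) n₀, quadTerm ε₀ α X i n s * X i n s := by
            gcongr with i _ n _
            exact henergy i n s hs
        _ ≤ K * windowEnergy E n₀ N s + δ N :=
            sum_quadTerm_mul_le_window hε₀ hM (fun j k => hbound j k s (Ico_subset_Icc_self hs)) hnonneg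
              (fun j k => hlower j k s (Ico_subset_Icc_self hs))
  -- the energy of the mode is at most every window energy containing it
  have hle : ∀ N : ℕ, n₀ - n ≤ N → E i n t ≤ gronwallBound 0 K (δ N) t := by
    intro N hN
    have h1 : E i n t ≤ windowEnergy E n₀ N t := by
      unfold windowEnergy
      refine le_trans ?_ (Finset.single_le_sum (f := fun i => ∑ n ∈ Finset.Ico (n₀ - N) n₀, E i n t)
        (fun _ _ => Finset.sum_nonneg fun _ _ => hnonneg _ _ _) (Finset.mem_univ i))
      exact Finset.single_le_sum (f := fun n => E i n t) (fun _ _ => hnonneg _ _ _)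
        (Finset.mem_Ico.2 ⟨by omega, hn⟩)
    have h2 := hwin N t ht
    rw [sub_zero] at h2
    exact h1.trans h2
  -- and the Gronwall bounds tend to zero with the inhomogeneity
  have hδlim : Tendsto δ atTop (𝓝 0) := by
    have h := (tendsto_scaleFactor hε₀ (n₀ - 1)).const_mul (4 * (m : ℝ) ^ 3 * (coeffBound α * M ^ 2) / 2)
    rw [mul_zero] at h
    refine h.congr fun N => ?_
    simp only [hδ]
    ring_nf
  have hGlim : Tendsto (fun N => gronwallBound 0 K (δ N) t) atTop (𝓝 0) := by
    have hc : Continuous fun ε => gronwallBound 0 K ε t := gronwallBound_continuous_ε 0 K t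
    have h0 : gronwallBound 0 K 0 t = 0 := gronwallBound_ε0_δ0 K t
    have h := (hc.tendsto 0).comp hδlim
    rw [h0] at h
    exact h
  have hE0 : E i n t ≤ 0 :=
    ge_of_tendsto hGlim (Filter.eventually_atTop.2 ⟨(n₀ - n).toNat, fun N hN => hle N (by omega)⟩)
  exact le_antisymm hE0 (hnonneg i n t)

/-- **The modes below the initial scale vanish** ((4.13) of Tao's Lemma 4.1, coefficient half):
under the hypotheses of `lowMode_energy_eq_zero`, also `X_{i,n} = 0` on `[0,T]` for `n < n₀`
(from `½ X² ≤ E = 0`). [cite: Tao2016AveragedNS, Lemma 4.1 (4.13)] -/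
theorem lowMode_coeff_eq_zero (hε₀ : 0 < ε₀) (α : Fin m → Fin m → Fin m → ℤ × ℤ × ℤ → ℝ) (n₀ : ℤ)
    (X E dE : Fin m → ℤ → ℝ → ℝ) {T : ℝ}
    (hcont : ∀ i n, ContinuousOn (E i n) (Icc 0 T))
    (hderiv : ∀ i n, ∀ t ∈ Ico 0 T, HasDerivWithinAt (E i n) (dE i n t) (Ici t) t)
    (henergy : ∀ i n, ∀ t ∈ Ico 0 T, dE i n t ≤ quadTerm ε₀ α X i n t * X i n t)
    (hlower : ∀ i n, ∀ t ∈ Icc 0 T, (1 / 2) * X i n t ^ 2 ≤ E i n t)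
    (hnonneg : ∀ i n t, 0 ≤ E i n t)
    (hinit : ∀ i n, n < n₀ → E i n 0 = 0)
    {M : ℝ} (hM : 0 ≤ M) (hbound : ∀ i n, ∀ t ∈ Icc 0 T, |X i n t| ≤ M) :
    ∀ i n, n < n₀ → ∀ t ∈ Icc 0 T, X i n t = 0 := by
  intro i n hn t ht
  have hE := lowMode_energy_eq_zero hε₀ α n₀ X E dE hcont hderiv henergy hlower hnonneg hinit hM hbound
    i n hn t ht
  have h := hlower i n t ht
  rw [hE] at h
  nlinarith [sq_nonneg (X i n t)]

end TaoCascade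

end Literature.Analysis.FluidPDE
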